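import Summits.ValiantsHypothesis.ValiantsHypothesis.Theorems.LacunarySymmetroidMatrixDescartesRoucheWindowKit

/-!
# `MatrixDescartes` — the TWO-LETTER ROUCHÉ WINDOW LAW (certificate form), dominance regions, assembly

HONEST FRAMING.  Object-search cell `pub-symmetroid`, crux `Theses.LacunarySymmetroid.MatrixDescartes`
(ledger item `stmt-ValiantsHypothesis-18050`, route `LacunarySymmetroid`; seat `val-sym-mdr-p2`, gen 12).  The
crux implies `VP ≠ VNP` by the route's assembly; NOTHING here is progress on it and nothing here is a claim
about `VP ≠ VNP`, `DoorA26` / `DoorA34` or the cell's registers.  This file proves a MAGNITUDE-HYPOTHESIS law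
for real lacunary pencils `F = ∑ₗ X^(d l) • S l` with ARBITRARY real `m × m` letters (no symmetry, rank,
commutation or definiteness hypothesis), at the matrix level of the lifting vocabulary (`HOME/…/GAP-LIFT.md`
§3 (M2), §4 (S-near): «near-tropical pencils are tame») but with the determinantal count `m` per hand-over of
dominance instead of a Descartes count of monomials:

* §4 **TWO-LETTER ROUCHÉ WINDOW LAW** (`card_realRoots_window_le`).  Pick two letters `a, b` with
  `d a < d b` (gap `g`) and a disc `|z − c| < r`, `0 < r < c`, with `r ≤ c·sin(π/g)` when `g ≥ 2`.  If on the
  circle `|z − c| = r` the two-letter comparison dominates,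
  `‖det F(z) − det(z^(d a) S a + z^(d b) S b)‖ < ‖det(z^(d a) S a + z^(d b) S b)‖`, then `det F` has at most
  `m` distinct real zeros in `(c − r, c + r)`.  Proof: Rouché's theorem in exact-count form (tree
  `Literature.Analysis.Complex.Rouche.finsum_analyticOrderNatAt_eq_of_norm_sub_lt`) and the kit's count
  `card_roots_twoLetter_filter_ball_le` (`det(z^(d a)A + z^(d b)B) = z^(m·d a)·p(z^g)`, `deg p ≤ m`, and `z ↦ z^g`
  is injective on the sector disc).  The certificate is ONE strict inequality on ONE circle — checkable by
  interval arithmetic for a given pencil; a structural sufficient condition (letter norms and exponent gaps)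
  is the business of a separate file.
* §5 **DOMINANCE** (`det_ne_zero_of_rowSum_lt_one`, `not_isRoot_of_dominance`): if some preconditioner `R`
  makes every absolute row sum of `1 − R·F(x)` less than `1`, then `det F(x) ≠ 0` (Lévy–Desplanques with a
  preconditioner; typical `R = (x^(d l₀) S l₀)⁻¹` on an interval where the letter `l₀` dominates).
* §6 **ASSEMBLY** (`card_posRoots_le_of_windows`): if the positive axis is covered by `N` certified windows
  and a certified dominance region, then `Z₊ ≤ N·m`; with one window per hand-over of dominance between
  consecutive letters (`N ≤ K − 1`) this is the matrix Descartes count `m(K−1)` — the «diagonal» column of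
  the cell's Table S — for pencils whose letters hand over dominance one at a time («letter-separated»).

WHAT THIS IS NOT.  The extremal census rows of the cell (γ-ladder, flags, grafts) are cancellation
configurations with clustered roots and near-null ends: they are as far from letter-separated as possible, and
no window certificate holds there.  The law says where real zeros of a near-tropical pencil can be and how
many each hand-over can carry; it is silent about overlapping hand-overs.  Numerics (seat folder
`exp/window_check.py`, hub, 20 s): random indefinite `3 × 3` letters, exponents `(0,5,10,15)`, hand-overs at
`10, 10², 10³`: the three circle certificates hold with ratios `4·10⁻⁴, 2·10⁻³, 4·10⁻³` and all real zeros lie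
in the windows.

[folklore] Rouché: J. B. Conway, *Functions of One Complex Variable I*, V §3 Thm 3.8 (tree file
`Literature/Analysis/Complex/RoucheTheorem.lean`); Lévy–Desplanques: elementary.
-/

-- `Summit.ValiantsHypothesis.ValiantsHypothesis.…` repeats a component by the D-0017 layout
-- (single-conjunct summit), which the `dupNamespace` linter flags; the name is mandated.
set_option linter.dupNamespace false

namespace Summit.ValiantsHypothesis.ValiantsHypothesis.Theorems.LacunarySymmetroidMatrixDescartes.RoucheWindow

open Polynomial Complex Metric Set
open scoped BigOperators Matrix Real

/-! ## §4 The two-letter Rouché window law -/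

open Classical in
/-- **TWO-LETTER ROUCHÉ WINDOW LAW (certificate form).**  Let `F = ∑ₗ X^(d l) • S l` be ANY real `m × m`
lacunary pencil (no symmetry, rank or commutation hypothesis) and pick two letters `a, b` with `d a < d b`,
gap `g = d b − d a`.  Let `|z − c| < r` be a disc with `0 < r < c` which, when `g ≥ 2`, satisfies
`r ≤ c·sin(π/g)` (so it lies in the sector `|arg z| < π/g`).  If on the circle `|z − c| = r` the two-letter
comparison dominates,
`‖det F(z) − det(z^(d a) S a + z^(d b) S b)‖ < ‖det(z^(d a) S a + z^(d b) S b)‖`,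
then `det F` has AT MOST `m` distinct real zeros in the window `(c − r, c + r)` — the matrix Descartes count
for one hand-over of dominance.  Proof: Rouché in exact-count form (tree
`Literature.Analysis.Complex.Rouche.finsum_analyticOrderNatAt_eq_of_norm_sub_lt`) equates the zeros of
`det F` and of the two-letter determinant in the disc, counted with multiplicity; the latter number is
`≤ m` (`card_roots_twoLetter_filter_ball_le`); real zeros in the window are complex zeros in the disc.
[folklore; Rouché: Conway, Functions of One Complex Variable I, V.3.8] -/
theorem card_realRoots_window_le {K m : ℕ} (d : Fin K → ℕ) (S : Fin K → Matrix (Fin m) (Fin m) ℝ)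
    (a b : Fin K) (hab : d a < d b) {c r : ℝ} (hr : 0 < r) (hrc : r < c)
    (hrs : 2 ≤ d b - d a → r ≤ c * Real.sin (π / (d b - d a : ℕ)))
    (hcert : ∀ z ∈ sphere (c : ℂ) r,
      ‖Matrix.det (∑ l, (z ^ d l) • (S l).map (algebraMap ℝ ℂ)) -
          Matrix.det ((z ^ d a) • (S a).map (algebraMap ℝ ℂ) + (z ^ d b) • (S b).map (algebraMap ℝ ℂ))‖ <
        ‖Matrix.det ((z ^ d a) • (S a).map (algebraMap ℝ ℂ) + (z ^ d b) • (S b).map (algebraMap ℝ ℂ))‖) :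
    ((Matrix.det (∑ l, ((X : ℝ[X]) ^ d l) • (S l).map C)).roots.toFinset.filter
        (fun x => c - r < x ∧ x < c + r)).card ≤ m := by
  classical
  set f : ℝ[X] := Matrix.det (∑ l, ((X : ℝ[X]) ^ d l) • (S l).map C) with hf_def
  set T : Fin K → Matrix (Fin m) (Fin m) ℂ := fun l => (S l).map (algebraMap ℝ ℂ) with hT_def
  set fC : ℂ[X] := Matrix.det (∑ l, ((X : ℂ[X]) ^ d l) • (T l).map C) with hfC_def
  set G : ℂ[X] := Matrix.det (((X : ℂ[X]) ^ d a) • (T a).map C + ((X : ℂ[X]) ^ d b) • (T b).map C)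
    with hG_def
  have hfC : f.map (algebraMap ℝ ℂ) = fC := map_det_pencil d S
  -- the certificate in polynomial language
  have hcert' : ∀ z ∈ sphere (c : ℂ) r, ‖fC.eval z - G.eval z‖ < ‖G.eval z‖ := by
    intro z hz
    rw [hfC_def, hG_def, eval_det_pencil, eval_det_twoLetter]
    exact hcert z hz
  -- a point of the circle
  have hpt : ((c + r : ℝ) : ℂ) ∈ sphere (c : ℂ) r := by
    rw [mem_sphere, dist_eq_norm, ofReal_add, add_sub_cancel_left, Complex.norm_real, Real.norm_eq_abs,
      abs_of_pos hr]
  have hG0 : G ≠ 0 := by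
    intro h
    have := hcert' _ hpt
    rw [h, eval_zero, sub_zero, norm_zero] at this
    exact (norm_nonneg _).not_gt this
  have hfC0 : fC ≠ 0 := by
    intro h
    have := hcert' _ hpt
    rw [h, eval_zero, zero_sub, norm_neg] at this
    exact lt_irrefl _ this
  have hf0 : f ≠ 0 := by
    intro h
    apply hfC0
    rw [← hfC, h, Polynomial.map_zero]
  -- Rouché, exact-count form
  have hR := Literature.Analysis.Complex.Rouche.finsum_analyticOrderNatAt_eq_of_norm_sub_lt
    (fun z => fC.eval z) (fun z => G.eval z) c r hr
    ⟨univ, isOpen_univ, subset_univ _, (Polynomial.differentiable fC).differentiableOn,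
      (Polynomial.differentiable G).differentiableOn⟩ hcert'
  rw [finsum_mem_ball_eq_card_roots_filter hfC0, finsum_mem_ball_eq_card_roots_filter hG0] at hR
  -- right-hand side: at most `m`
  have hm : Multiset.card (G.roots.filter (fun z => z ∈ ball (c : ℂ) r)) ≤ m :=
    card_roots_twoLetter_filter_ball_le hab (T a) (T b) hr hrc hrs hG0
  -- left-hand side: at least the number of distinct real zeros in the window
  have hinj : ((f.roots.toFinset.filter (fun x => c - r < x ∧ x < c + r)).image
      (fun x : ℝ => (x : ℂ))) ⊆ fC.roots.toFinset.filter (fun z => z ∈ ball (c : ℂ) r) := by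
    intro z hz
    obtain ⟨x, hx, rfl⟩ := Finset.mem_image.1 hz
    rw [Finset.mem_filter, Multiset.mem_toFinset, mem_roots hf0] at hx
    rw [Finset.mem_filter, Multiset.mem_toFinset, mem_roots hfC0, ← hfC, IsRoot.def, eval_map_ofReal,
      hx.1.eq_zero, ofReal_zero, mem_ball, dist_eq_norm, ← ofReal_sub, Complex.norm_real,
      Real.norm_eq_abs, abs_lt]
    exact ⟨rfl, by linarith [hx.2.1], by linarith [hx.2.2]⟩
  calc (f.roots.toFinset.filter (fun x => c - r < x ∧ x < c + r)).card
      = ((f.roots.toFinset.filter (fun x => c - r < x ∧ x < c + r)).image (fun x : ℝ => (x : ℂ))).card :=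
        (Finset.card_image_of_injective _ Complex.ofReal_injective).symm
    _ ≤ (fC.roots.toFinset.filter (fun z => z ∈ ball (c : ℂ) r)).card := Finset.card_le_card hinj
    _ ≤ Multiset.card (fC.roots.filter (fun z => z ∈ ball (c : ℂ) r)) := card_roots_toFinset_filter_le _ _
    _ = Multiset.card (G.roots.filter (fun z => z ∈ ball (c : ℂ) r)) := hR
    _ ≤ m := hm


/-! ## §5 Dominance: a preconditioned row-sum certificate excludes zeros -/

/-- **Row-sum dominance (Lévy–Desplanques with a preconditioner).**  If for some real matrix `R` every row
of `1 − R·M` has absolute row sum `< 1`, then `M` has trivial kernel, hence `det M ≠ 0`.  (Take a kernel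
vector `v ≠ 0` and a coordinate of maximal modulus.) [folklore] -/
theorem det_ne_zero_of_rowSum_lt_one {m : ℕ} (M R : Matrix (Fin m) (Fin m) ℝ)
    (hrow : ∀ i, ∑ j, |(1 - R * M) i j| < 1) : M.det ≠ 0 := by
  classical
  intro hdet
  obtain ⟨v, hv0, hv⟩ := Matrix.exists_mulVec_eq_zero_iff.2 hdet
  -- `(1 - R M) v = v`
  have hfix : (1 - R * M).mulVec v = v := by
    rw [Matrix.sub_mulVec, Matrix.one_mulVec, ← Matrix.mulVec_mulVec, hv, Matrix.mulVec_zero, sub_zero]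
  -- a coordinate of maximal modulus
  have hne : (Finset.univ : Finset (Fin m)).Nonempty := by
    by_contra h
    rw [Finset.not_nonempty_iff_eq_empty, Finset.univ_eq_empty_iff] at h
    exact hv0 (funext fun i => (h.elim i))
  obtain ⟨i, -, hi⟩ := Finset.exists_max_image Finset.univ (fun j => |v j|) hne
  have hvi : 0 < |v i| := by
    by_contra hle
    rw [not_lt] at hle
    apply hv0
    funext j
    have := (hi j (Finset.mem_univ j)).trans hle
    exact abs_eq_zero.1 (le_antisymm this (abs_nonneg _))
  have key : |v i| ≤ (∑ j, |(1 - R * M) i j|) * |v i| := by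
    conv_lhs => rw [← hfix]
    rw [Matrix.mulVec, dotProduct, Finset.sum_mul]
    refine (Finset.abs_sum_le_sum_abs _ _).trans (Finset.sum_le_sum fun j _ => ?_)
    rw [abs_mul]
    exact mul_le_mul_of_nonneg_left (hi j (Finset.mem_univ j)) (abs_nonneg _)
  have : (∑ j, |(1 - R * M) i j|) * |v i| < 1 * |v i| := mul_lt_mul_of_pos_right (hrow i) hvi
  linarith

/-- **No zeros on a dominance interval.**  If at every point `x` of a set `D ⊆ ℝ` some preconditioner
`R x` makes all row sums of `1 − R x · F(x)` less than `1` (`F(x) = ∑ₗ x^(d l) S l`), then `det F` has no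
zero in `D`.  Typical use: on an interval where the letter `l₀` dominates, `R x = (x^(d l₀) S l₀)⁻¹`. [folklore] -/
theorem not_isRoot_of_dominance {K m : ℕ} (d : Fin K → ℕ) (S : Fin K → Matrix (Fin m) (Fin m) ℝ)
    {D : Set ℝ} (R : ℝ → Matrix (Fin m) (Fin m) ℝ)
    (hdom : ∀ x ∈ D, ∀ i, ∑ j, |(1 - R x * ∑ l, (x ^ d l) • S l) i j| < 1) {x : ℝ} (hx : x ∈ D) :
    ¬ (Matrix.det (∑ l, ((X : ℝ[X]) ^ d l) • (S l).map C)).IsRoot x := by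
  intro hroot
  rw [IsRoot.def, ← Polynomial.coe_evalRingHom, RingHom.map_det] at hroot
  have he : (evalRingHom x).mapMatrix (∑ l, ((X : ℝ[X]) ^ d l) • (S l).map C) = ∑ l, (x ^ d l) • S l := by
    ext i j
    simp [Matrix.sum_apply, Matrix.smul_apply, Matrix.map_apply]
    exact Finset.sum_congr rfl fun _ _ => mul_comm _ _
  rw [he] at hroot
  exact det_ne_zero_of_rowSum_lt_one _ (R x) (hdom x hx) hroot

/-! ## §6 Assembly: windows and dominance regions covering the positive axis -/

open Classical in
/-- **WINDOW ASSEMBLY.**  Let `F = ∑ₗ X^(d l) • S l` be a real lacunary pencil and suppose the positive axis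
is covered by `N` certified two-letter Rouché windows `(c j − r j, c j + r j)` (each with its letter pair
`a j, b j`, `d (a j) < d (b j)`, radius in the sector range, and the circle certificate of
`card_realRoots_window_le`) together with a dominance region `D` carrying a row-sum certificate
(`not_isRoot_of_dominance`).  Then `det F` has at most `N·m` distinct positive zeros — `m` per hand-over
of dominance.  With `N ≤ K − 1` hand-overs this is the matrix Descartes count `m(K−1)`. [folklore] -/
theorem card_posRoots_le_of_windows {K m N : ℕ} (d : Fin K → ℕ) (S : Fin K → Matrix (Fin m) (Fin m) ℝ)
    (a b : Fin N → Fin K) (hab : ∀ j, d (a j) < d (b j)) (c r : Fin N → ℝ)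
    (hr : ∀ j, 0 < r j) (hrc : ∀ j, r j < c j)
    (hrs : ∀ j, 2 ≤ d (b j) - d (a j) → r j ≤ c j * Real.sin (π / (d (b j) - d (a j) : ℕ)))
    (hcert : ∀ j, ∀ z ∈ sphere (c j : ℂ) (r j),
      ‖Matrix.det (∑ l, (z ^ d l) • (S l).map (algebraMap ℝ ℂ)) -
          Matrix.det ((z ^ d (a j)) • (S (a j)).map (algebraMap ℝ ℂ) +
            (z ^ d (b j)) • (S (b j)).map (algebraMap ℝ ℂ))‖ <
        ‖Matrix.det ((z ^ d (a j)) • (S (a j)).map (algebraMap ℝ ℂ) +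
            (z ^ d (b j)) • (S (b j)).map (algebraMap ℝ ℂ))‖)
    (D : Set ℝ) (R : ℝ → Matrix (Fin m) (Fin m) ℝ)
    (hdom : ∀ x ∈ D, ∀ i, ∑ j, |(1 - R x * ∑ l, (x ^ d l) • S l) i j| < 1)
    (hcover : ∀ x : ℝ, 0 < x → x ∈ D ∨ ∃ j, c j - r j < x ∧ x < c j + r j) :
    ((Matrix.det (∑ l, ((X : ℝ[X]) ^ d l) • (S l).map C)).roots.toFinset.filter (fun t => 0 < t)).card
      ≤ N * m := by
  classical
  set f : ℝ[X] := Matrix.det (∑ l, ((X : ℝ[X]) ^ d l) • (S l).map C) with hf_def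
  by_cases hf0 : f = 0
  · rw [hf0, roots_zero, Multiset.toFinset_zero, Finset.filter_empty, Finset.card_empty]
    exact Nat.zero_le _
  -- every positive root lies in some window
  have hsub : f.roots.toFinset.filter (fun t => 0 < t) ⊆
      (Finset.univ : Finset (Fin N)).biUnion
        (fun j => f.roots.toFinset.filter (fun x => c j - r j < x ∧ x < c j + r j)) := by
    intro x hx
    rw [Finset.mem_filter, Multiset.mem_toFinset, mem_roots hf0] at hx
    rcases hcover x hx.2 with hD | ⟨j, hj⟩
    · exact absurd hx.1 (not_isRoot_of_dominance d S R hdom hD)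
    · rw [Finset.mem_biUnion]
      refine ⟨j, Finset.mem_univ j, ?_⟩
      rw [Finset.mem_filter, Multiset.mem_toFinset, mem_roots hf0]
      exact ⟨hx.1, hj⟩
  calc (f.roots.toFinset.filter (fun t => 0 < t)).card
      ≤ ((Finset.univ : Finset (Fin N)).biUnion
          (fun j => f.roots.toFinset.filter (fun x => c j - r j < x ∧ x < c j + r j))).card :=
        Finset.card_le_card hsub
    _ ≤ ∑ j : Fin N, (f.roots.toFinset.filter (fun x => c j - r j < x ∧ x < c j + r j)).card :=
        Finset.card_biUnion_le
    _ ≤ ∑ _j : Fin N, m :=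
        Finset.sum_le_sum fun j _ => card_realRoots_window_le d S (a j) (b j) (hab j) (hr j) (hrc j)
          (hrs j) (hcert j)
    _ = N * m := by rw [Finset.sum_const, Finset.card_univ, Fintype.card_fin, smul_eq_mul]

end Summit.ValiantsHypothesis.ValiantsHypothesis.Theorems.LacunarySymmetroidMatrixDescartes.RoucheWindow
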